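import Literature.AnabelianGeometry.SemiGraphs.IwahoriMetabelianLeaves
import Literature.AnabelianGeometry.SemiGraphs.CharacteristicOpenCoreRetraction
import Literature.AnabelianGeometry.SemiGraphs.ThetaRayGraphQuasiCoherent
import Literature.AnabelianGeometry.SemiGraphs.FreeProPRankTwoGluing
import HarnessLib

/-!
# Compatible open normal LEVELS of the rayless counter-carrier `𝒢⋆(p)` («RAYLESS-STAR·CIV-NEG», brick S4,
# part 1): centre cores, leaf levels, and the common edge level

Mochizuki, *Semi-graphs of anabelioids*, Publ. RIMS **42** (2006), Def. 2.3 (i)–(iii) pp. 24–25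
(approximators, quasi-coherence) [cite: MochizukiSemiAnbd2006, Def 2.3 pp.24-25]; the characteristic open
subgroups of bounded index [cite: DixonEtAl1999, Prop 1.6].

PROOF/DEFINITION file (abc-iut cell, layer L3, row «RAYLESS-STAR·CIV-NEG», seat abc-iut-L3-t8 gen 6; desk memo
§6).  The data fed to abc-iut-w4-d075's constructor `isQuasiCoherent_of_compatibleLevels` for the leaf-star
`𝒢⋆(p)` of `MetabelianLeafStar.lean` (bound `M`):

* CENTRE level `centreLevel p M = charOpenCore F̂₂⁽ᵖ⁾ M ⊓ K_M`, `K_M = ab⁻¹(p^M ℤ_p × p^M ℤ_p)` — open, normal, of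
  finite index, STABLE under the Nielsen automorphisms `θₙ` (so that ALL centre gluings `θα p n = θₙ ∘ α` pull
  it back to ONE subgroup of `ℤ_p`);
* EDGE level `edgeLevel p M = α⁻¹(centreLevel p M) ≤ p^M ℤ_p`;
* the preparatory `ℤ_p`-lemmas: a subgroup of `ℤ_p` of index `≤ M` contains `p^M ℤ_p`
  (`PadicIntLevels.ofAdd_pow_mul_mem`), and `u_n^{p^j t} ≡ 1 (mod p^{n+j+1})` (`IwU.toMod_zpowGen_eq_one`);
* the centre / edge levels FIX every finite continuous set with at most `M` points of the respective group.
The LEAF levels are in the companion file `MetabelianLeafStarLeafLevels.lean`.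

No named fact; no side taken on [IUTchIII] Cor 3.12.
-/

noncomputable section

open scoped Pointwise
open Topology Multiplicative Filter

namespace Literature.AnabelianGeometry.SemiGraphs

open IwahoriWitness
open Literature.AnabelianGeometry.AbsoluteAnabelian (IsTopologicallyFinitelyGenerated)

variable {p : ℕ} [hp : Fact p.Prime]

/-! ## 1. Subgroups of `ℤ_p` of index `≤ M` contain `p^M ℤ_p` -/

namespace PadicIntLevels

/-- A subgroup of `ℤ_p` (written multiplicatively) of index `k` with `0 < k ≤ M` contains `p^M t` for every
`t`: it contains all `k`-th powers, and `k ∣ M!`, `M! = p^v·m` with `m` a `p`-adic unit and `v ≤ M`… — in the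
elementary form `p^M t = (M!) · s` up to the unit `m`. [cite: RibesZalesskii2010, §4.1] -/
theorem ofAdd_factorial_mul_mem {K : Subgroup (Multiplicative ℤ_[p])} {M : ℕ} (hK0 : K.index ≠ 0)
    (hKM : K.index ≤ M) (t : ℤ_[p]) : ofAdd (((M.factorial : ℕ) : ℤ_[p]) * t) ∈ K := by
  obtain ⟨c, hc⟩ := Nat.dvd_factorial (Nat.pos_of_ne_zero hK0) hKM
  have h : ofAdd (((M.factorial : ℕ) : ℤ_[p]) * t) = (ofAdd ((c : ℤ_[p]) * t)) ^ K.index := by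
    rw [← ofAdd_nsmul, nsmul_eq_mul, ← mul_assoc, ← Nat.cast_mul, ← hc]
  rw [h]
  exact K.pow_index_mem _

/-- `M! = p^{v} · m` with `p ∤ m`; the prime-to-`p` part `m` is a unit of `ℤ_p`, so `p^{v} t ∈ (M!)·ℤ_p` for
every `t`, where `v = v_p(M!) ≤ M`.  Packaged: a subgroup of index `0 < k ≤ M` contains `p^M t`.
[cite: RibesZalesskii2010, §4.1] -/
theorem ofAdd_pow_mul_mem {K : Subgroup (Multiplicative ℤ_[p])} {M : ℕ} (hK0 : K.index ≠ 0)
    (hKM : K.index ≤ M) (t : ℤ_[p]) : ofAdd ((p : ℤ_[p]) ^ M * t) ∈ K := by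
  -- write `M! = p^v * m` with `p ∤ m`
  have hfac : M.factorial ≠ 0 := Nat.factorial_ne_zero M
  set v : ℕ := (M.factorial).factorization p with hv
  obtain ⟨m, hm, hmul⟩ : ∃ m : ℕ, ¬ p ∣ m ∧ M.factorial = p ^ v * m :=
    ⟨M.factorial / p ^ v, Nat.not_dvd_ordCompl hp.out hfac, (Nat.ordProj_mul_ordCompl_eq_self _ _).symm⟩
  -- `m` is a unit of `ℤ_p`
  have hmunit : IsUnit ((m : ℕ) : ℤ_[p]) := by
    rw [PadicInt.isUnit_iff]
    by_contra hne
    have hlt : ‖((m : ℤ) : ℤ_[p])‖ < 1 := by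
      rw [Int.cast_natCast]; exact lt_of_le_of_ne (PadicInt.norm_le_one _) hne
    rw [PadicInt.norm_int_lt_one_iff_dvd] at hlt
    exact hm (by exact_mod_cast hlt)
  obtain ⟨u, hu⟩ := hmunit
  -- `v ≤ M` (Legendre)
  have hvM : v ≤ M := by
    have hvp : padicValNat p M.factorial = v := by
      rw [hv, Nat.factorization_def _ hp.out]
    rw [← hvp]
    exact padicValNat_factorial_le (p := p) M
  -- `p^M t = M! * (p^(M-v) * u⁻¹ * t)`
  have key : (p : ℤ_[p]) ^ M * t = ((M.factorial : ℕ) : ℤ_[p]) * ((p : ℤ_[p]) ^ (M - v) * ↑u⁻¹ * t) := by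
    rw [hmul, Nat.cast_mul, Nat.cast_pow, ← hu]
    have : (p : ℤ_[p]) ^ M = (p : ℤ_[p]) ^ v * (p : ℤ_[p]) ^ (M - v) := by
      rw [← pow_add, Nat.add_sub_cancel' hvM]
    rw [this]
    have hu1 : (u : ℤ_[p]) * ↑u⁻¹ = 1 := Units.mul_inv u
    linear_combination (-((p : ℤ_[p]) ^ v * (p : ℤ_[p]) ^ (M - v) * t)) * hu1
  rw [key]
  exact ofAdd_factorial_mul_mem hK0 hKM _

/-- The pre-image under a homomorphism `f : ℤ_p → Γ` of a subgroup of finite index `≤ M` contains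
`p^M ℤ_p` (index of the pre-image `≤` index). [cite: RibesZalesskii2010, §4.1] -/
theorem ofAdd_pow_mul_mem_comap {Γ : Type*} [Group Γ] (f : Multiplicative ℤ_[p] →* Γ) {S : Subgroup Γ}
    {M : ℕ} (hS0 : S.index ≠ 0) (hSM : S.index ≤ M) (t : ℤ_[p]) :
    ofAdd ((p : ℤ_[p]) ^ M * t) ∈ S.comap f := by
  have h0 : (S.comap f).index ≠ 0 := by
    rw [Subgroup.index_comap]
    exact fun h => hS0 (Subgroup.index_eq_zero_of_relIndex_eq_zero h)
  have hle : (S.comap f).index ≤ M := by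
    rw [Subgroup.index_comap]
    exact (Subgroup.relIndex_le_of_le_right le_top (by rwa [Subgroup.relIndex_top_right])).trans
      (by rw [Subgroup.relIndex_top_right]; exact hSM)
  exact ofAdd_pow_mul_mem h0 hle t

end PadicIntLevels

/-! ## 2. Powers of the units `u_n` climb the level filtration of `U` -/

namespace IwU

/-- `p`-th powers climb one level: `z ∈ ker(U → U_m) ⇒ z^p ∈ ker(U → U_{m+1})`.
[cite: IrelandRosen1990, Ch. 4 §1 Thm. 2 (proof)] -/
theorem toMod_pow_prime_eq_one {m : ℕ} {z : IwU p} (hz : toMod m z = 1) : toMod (m + 1) (z ^ p) = 1 := by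
  rw [toMod_eq_one_iff_dvd] at hz ⊢
  obtain ⟨c, hc⟩ := hz
  obtain ⟨r, hr⟩ := exists_pow_s_eq m z c hc p
  exact ⟨c + r, by rw [hr]; ring⟩

/-- `u_n^{p^j} ∈ ker(U → U_{n+j})` (`u_n = 1 + p^{n+1}`). [cite: IrelandRosen1990, Ch. 4 §1 Thm. 2 (proof)] -/
theorem toMod_gen_pow_eq_one (n j : ℕ) : toMod (n + j) (gen (p := p) n ^ p ^ j) = 1 := by
  induction j with
  | zero =>
    rw [pow_zero, pow_one, Nat.add_zero, toMod_eq_one_iff_dvd, gen_s]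
  | succ j ih =>
    rw [pow_succ, pow_mul, ← Nat.add_assoc]
    exact toMod_pow_prime_eq_one ih

/-- `u_n^{p^j t} ∈ ker(U → U_{n+j})` for every `t ∈ ℤ_p` (density of `ℤ` in `ℤ_p`, the kernel being closed).
[cite: RibesZalesskii2010, §4.1] -/
theorem toMod_zpowGen_eq_one (n j : ℕ) (t : ℤ_[p]) :
    toMod (n + j) (zpowGen (p := p) n (ofAdd ((p : ℤ_[p]) ^ j * t))) = 1 := by
  let g : ℤ_[p] → IwU p := fun t => zpowGen (p := p) n (ofAdd ((p : ℤ_[p]) ^ j * t))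
  have hc : Continuous g :=
    (zpowGen (p := p) n).continuous.comp (continuous_ofAdd.comp (continuous_const.mul continuous_id))
  have hK : IsClosed (((toMod (p := p) (n + j)).ker : Subgroup (IwU p)) : Set (IwU p)) :=
    Subgroup.isClosed_of_isOpen _ (isOpen_ker_toMod _)
  have hclosed : IsClosed (g ⁻¹' (((toMod (p := p) (n + j)).ker : Subgroup (IwU p)) : Set (IwU p))) :=
    hK.preimage hc
  have hZ : Set.range (Int.cast : ℤ → ℤ_[p]) ⊆
      g ⁻¹' (((toMod (p := p) (n + j)).ker : Subgroup (IwU p)) : Set (IwU p)) := by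
    rintro _ ⟨k, rfl⟩
    change zpowGen (p := p) n (ofAdd ((p : ℤ_[p]) ^ j * (k : ℤ_[p]))) ∈ (toMod (p := p) (n + j)).ker
    have hcast : (p : ℤ_[p]) ^ j * (k : ℤ_[p]) = (((p ^ j : ℕ) * k : ℤ) : ℤ_[p]) := by push_cast; ring
    rw [hcast, zpowGen_ofAdd_intCast, zpow_mul, zpow_natCast, MonoidHom.mem_ker, map_zpow,
      toMod_gen_pow_eq_one, one_zpow]
  have hall : (Set.univ : Set ℤ_[p]) ⊆ g ⁻¹' (((toMod (p := p) (n + j)).ker : Subgroup (IwU p)) : Set (IwU p)) := by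
    rw [← PadicInt.denseRange_intCast.closure_range]
    exact hclosed.closure_subset_iff.mpr hZ
  exact hall (Set.mem_univ t)

end IwU


/-! ## 3. The CENTRE level: characteristic open core meet the mod-`p^M` abelianisation kernel -/

namespace FreeProPRankTwo

variable (p)

/-- The box `p^g ℤ_p × p^g ℤ_p` as a subgroup of the (multiplicatively written) abelianisation target.
[cite: MochizukiSemiAnbd2006, Def 2.3(i) p.24] -/
def boxLevel (g : ℕ) : Subgroup (Multiplicative (ℤ_[p] × ℤ_[p])) :=
  AddSubgroup.toSubgroup
    (((Ideal.span {(p : ℤ_[p]) ^ g}).toAddSubgroup).prod ((Ideal.span {(p : ℤ_[p]) ^ g}).toAddSubgroup))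

/-- Membership in the box: both coordinates divisible by `p^g`. [cite: MochizukiSemiAnbd2006, Def 2.3(i) p.24] -/
theorem mem_boxLevel_iff (g : ℕ) (v : Multiplicative (ℤ_[p] × ℤ_[p])) :
    v ∈ boxLevel p g ↔ (p : ℤ_[p]) ^ g ∣ v.toAdd.1 ∧ (p : ℤ_[p]) ^ g ∣ v.toAdd.2 := by
  change v.toAdd ∈ ((Ideal.span {(p : ℤ_[p]) ^ g}).toAddSubgroup).prod _ ↔ _
  rw [AddSubgroup.mem_prod]
  simp only [Submodule.mem_toAddSubgroup, Ideal.mem_span_singleton]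

/-- The box is open (a product of closed balls of the ultrametric `ℤ_p`). [cite: MochizukiSemiAnbd2006, Def 2.3(i) p.24] -/
theorem isOpen_boxLevel (g : ℕ) : IsOpen (boxLevel p g : Set (Multiplicative (ℤ_[p] × ℤ_[p]))) := by
  have hball : IsOpen {x : ℤ_[p] | (p : ℤ_[p]) ^ g ∣ x} := by
    have h : {x : ℤ_[p] | (p : ℤ_[p]) ^ g ∣ x} = Metric.closedBall (0 : ℤ_[p]) ((p : ℝ) ^ (-(g : ℤ))) := by
      ext x
      rw [Set.mem_setOf_eq, Metric.mem_closedBall, dist_zero_right, PadicInt.norm_le_pow_iff_mem_span_pow,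
        Ideal.mem_span_singleton]
    rw [h]
    exact IsUltrametricDist.isOpen_closedBall _
      (ne_of_gt (zpow_pos (by exact_mod_cast hp.out.pos) _))
  have hset : (boxLevel p g : Set (Multiplicative (ℤ_[p] × ℤ_[p]))) =
      toAdd ⁻¹' ({x : ℤ_[p] | (p : ℤ_[p]) ^ g ∣ x} ×ˢ {x : ℤ_[p] | (p : ℤ_[p]) ^ g ∣ x}) := by
    ext v
    rw [SetLike.mem_coe, mem_boxLevel_iff]
    rfl
  rw [hset]
  exact (hball.prod hball).preimage continuous_toAdd

/-- `K_g := ab⁻¹(p^g ℤ_p × p^g ℤ_p)`, the kernel of `F̂₂⁽ᵖ⁾ → (ℤ/p^g)²`. [cite: MochizukiSemiAnbd2006, Def 2.3(i) p.24] -/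
def abLevel (g : ℕ) : Subgroup (Grp p) := (boxLevel p g).comap (ab p).toMonoidHom

/-- Membership in `K_g`. [cite: MochizukiSemiAnbd2006, Def 2.3(i) p.24] -/
theorem mem_abLevel_iff (g : ℕ) (x : Grp p) :
    x ∈ abLevel p g ↔ (p : ℤ_[p]) ^ g ∣ (ab p x).toAdd.1 ∧ (p : ℤ_[p]) ^ g ∣ (ab p x).toAdd.2 :=
  mem_boxLevel_iff p g _

/-- `K_g` is open. [cite: MochizukiSemiAnbd2006, Def 2.3(i) p.24] -/
theorem isOpen_abLevel (g : ℕ) : IsOpen (abLevel p g : Set (Grp p)) :=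
  (isOpen_boxLevel p g).preimage (ab p).continuous

/-- `K_g` is normal (the target is commutative). [cite: MochizukiSemiAnbd2006, Def 2.3(i) p.24] -/
theorem abLevel_normal (g : ℕ) : (abLevel p g).Normal := by
  unfold abLevel
  infer_instance

/-- `K_g` is stable under the Nielsen automorphism `θₙ` (`ab ∘ θₙ` is `ab` followed by the unimodular shear
`(u, v) ↦ (u, v + pⁿu)`). [cite: MochizukiSemiAnbd2006, Def 2.3(i) p.24] -/
theorem comap_θ_abLevel (g n : ℕ) : (abLevel p g).comap (θHom p n).toMonoidHom = abLevel p g := by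
  ext x
  rw [Subgroup.mem_comap, mem_abLevel_iff, mem_abLevel_iff]
  change (p : ℤ_[p]) ^ g ∣ (ab p (θ p n x)).toAdd.1 ∧ (p : ℤ_[p]) ^ g ∣ (ab p (θ p n x)).toAdd.2 ↔ _
  rw [ab_θ, toAdd_ofAdd]
  constructor
  · rintro ⟨h1, h2⟩
    refine ⟨h1, ?_⟩
    have h3 : (p : ℤ_[p]) ^ g ∣ (p : ℤ_[p]) ^ n * (ab p x).toAdd.1 := h1.mul_left _
    simpa using (dvd_sub h2 h3)
  · rintro ⟨h1, h2⟩
    exact ⟨h1, dvd_add h2 (h1.mul_left _)⟩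

/-- **The centre level** `centreLevel p M := charOpenCore F̂₂⁽ᵖ⁾ M ⊓ K_M`. [cite: MochizukiSemiAnbd2006, Def 2.3(iii) p.25] -/
def centreLevel (M : ℕ) : Subgroup (Grp p) := charOpenCore (Grp p) M ⊓ abLevel p M

/-- The centre level is normal. [cite: MochizukiSemiAnbd2006, Def 2.3(iii) p.25] -/
theorem centreLevel_normal (M : ℕ) : (centreLevel p M).Normal := by
  haveI := charOpenCore_normal (Γ := Grp p) M
  haveI := abLevel_normal p M
  unfold centreLevel
  infer_instance

/-- The centre level is open (the free pro-`p` group of rank two is topologically finitely generated).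
[cite: MochizukiSemiAnbd2006, Def 2.3(iii) p.25] -/
theorem isOpen_centreLevel (M : ℕ) : IsOpen (centreLevel p M : Set (Grp p)) := by
  rw [centreLevel, Subgroup.coe_inf]
  exact (isOpen_charOpenCore_of_tfg (isTopologicallyFinitelyGenerated p) M).inter (isOpen_abLevel p M)

/-- The centre level has finite index (open in a compact group). [cite: MochizukiSemiAnbd2006, Def 2.3(iii) p.25] -/
theorem centreLevel_index_ne_zero (M : ℕ) : (centreLevel p M).index ≠ 0 := by
  haveI := Subgroup.quotient_finite_of_isOpen _ (isOpen_centreLevel p M)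
  exact Subgroup.index_ne_zero_of_finite

/-- The centre level is `θₙ`-stable. [cite: MochizukiSemiAnbd2006, Def 2.3(iii) p.25] -/
theorem comap_θ_centreLevel (M n : ℕ) :
    (centreLevel p M).comap (θHom p n).toMonoidHom = centreLevel p M := by
  rw [centreLevel, Subgroup.comap_inf, comap_θ_abLevel,
    comap_charOpenCore_eq_of_bijective (θHom p n) (θ p n).bijective M]

/-- The centre level fixes every finite continuous `F̂₂⁽ᵖ⁾`-set with at most `M` points.
[cite: DixonEtAl1999, Prop 1.6] -/
theorem centreLevel_fixes (M : ℕ) (X : BTemp (Grp p)) [Finite X.obj.V] (hX : Nat.card X.obj.V ≤ M)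
    {g : Grp p} (hg : g ∈ centreLevel p M) (x : X.obj.V) : X.obj.ρ g x = x :=
  ρ_eq_of_mem_charOpenCore X hX hg.1 x

/-- **The edge level** `edgeLevel p M := α⁻¹(centreLevel p M) ≤ ℤ_p` (the same for every edge of the star).
[cite: MochizukiSemiAnbd2006, Def 2.3(iii) p.25] -/
def edgeLevel (M : ℕ) : Subgroup (Multiplicative ℤ_[p]) := (centreLevel p M).comap (α p).toMonoidHom

/-- Every centre gluing `θα p n` pulls the centre level back to the edge level.
[cite: MochizukiSemiAnbd2006, Def 2.3(iii) p.25] -/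
theorem comap_θα_centreLevel (M n : ℕ) :
    (centreLevel p M).comap (θα p n).toMonoidHom = edgeLevel p M := by
  have h : (θα p n).toMonoidHom = (θHom p n).toMonoidHom.comp (α p).toMonoidHom := rfl
  rw [h, ← Subgroup.comap_comap, comap_θ_centreLevel]
  rfl

/-- The edge level lies in `p^M ℤ_p` (read off the abelianisation: `ab(α t) = (t, 0)`).
[cite: MochizukiSemiAnbd2006, Def 2.3(iii) p.25] -/
theorem dvd_of_mem_edgeLevel {M : ℕ} {t : Multiplicative ℤ_[p]} (ht : t ∈ edgeLevel p M) :
    (p : ℤ_[p]) ^ M ∣ t.toAdd := by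
  have h := ((mem_abLevel_iff p M _).1 ht.2).1
  have h' : (ab p) ((α p).toMonoidHom t) = ab p (α p t) := rfl
  rwa [h', ab_α, toAdd_ofAdd] at h

/-- The edge level is open. [cite: MochizukiSemiAnbd2006, Def 2.3(iii) p.25] -/
theorem isOpen_edgeLevel (M : ℕ) : IsOpen (edgeLevel p M : Set (Multiplicative ℤ_[p])) :=
  (isOpen_centreLevel p M).preimage (α p).continuous

/-- The edge level has finite index (open in the compact `ℤ_p`). [cite: MochizukiSemiAnbd2006, Def 2.3(iii) p.25] -/
theorem edgeLevel_index_ne_zero (M : ℕ) : (edgeLevel p M).index ≠ 0 := by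
  haveI : CompactSpace (Multiplicative ℤ_[p]) := inferInstanceAs (CompactSpace ℤ_[p])
  haveI := Subgroup.quotient_finite_of_isOpen _ (isOpen_edgeLevel p M)
  exact Subgroup.index_ne_zero_of_finite

/-- The edge level fixes every finite continuous `ℤ_p`-set with at most `M` points (it lies in the
characteristic open core of `ℤ_p`, by the continuous retraction `χ_a` of `α`). [cite: DixonEtAl1999, Prop 1.6] -/
theorem edgeLevel_fixes (M : ℕ) (X : BTemp (Multiplicative ℤ_[p])) [Finite X.obj.V]
    (hX : Nat.card X.obj.V ≤ M) {t : Multiplicative ℤ_[p]} (ht : t ∈ edgeLevel p M) (x : X.obj.V) :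
    X.obj.ρ t x = x := by
  have h1 : t ∈ (charOpenCore (Grp p) M).comap (α p).toMonoidHom := ht.1
  have h2 := comap_charOpenCore_le_of_leftInverse (α p).toMonoidHom (χa p).toMonoidHom (χa p).continuous
    (fun x => χa_α p x) M h1
  exact ρ_eq_of_mem_charOpenCore X hX h2 x

end FreeProPRankTwo

end Literature.AnabelianGeometry.SemiGraphs

end
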